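import Summits.BirchSwinnertonDyer.Rank1Residual.X2.NonsplitHalvesOnTreeInt
import Summits.BirchSwinnertonDyer.Rank1Residual.X2.NonsplitCellCNotGVClass
import HarnessLib

/-!
# O9 ∩ {non-split} AT THE CLASS LEVEL over the WIDE receptacle: `X2c ∩ {non-split} ⇒ BSD(E,p)` from
# the two ♭ residuals c2♭, c3♭ + Mazur's main conjecture on X2b ∩ {non-split} + PUBLISHED facts — the
# residual c1 is GONE (cell `bsd-eis`, seat `bsd-eis-k5-c4`; route `EisensteinPrimes`, crux 4
# `BSDpOnCellC` = stmt-BirchSwinnertonDyer-19034, line b1: atoms c1 and c2¬split, RULING L7)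

HONEST FRAMING (cell `bsd-eis`): theorems only; nothing booked; X2 stays CONSTRUCTION-SHAPED; no
label moves. `X2/NonsplitCellCClass.lean` (p407684) and `X2/NonsplitCellCNotGVClass.lean` (p409029)
read the NON-SPLIT half of crux 4 as: PUBLISHED facts + c1 `HsiehFrameResidualAt` + c2
`NonsplitBDPValueOnTree` + c3 `NonsplitIMCEqOnTree` + [Mazur's MC on X2b ∩ {non-split}]. This file is
their twin over the wide receptacle `𝓞_{ℂ_p}⟦T⟧` (`X2/NonsplitBDPExistsInt.lean`,
`X2/NonsplitHalvesOnTreeInt.lean`): the frame comes from Hsieh 2014 Thm. 1 (PUB) and the tree theorem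
`X11b.lambdaSupplyAt` with NO residual, so the binder `hres` DISAPPEARS from every statement and the
halves are read ♭ (`NonsplitBDPValueOnTreeInt`, `NonsplitIMCEqOnTreeInt`). Every Heegner datum of the
(b1) road is PRODUCED exactly as in p407684 (Hoffstein–Luo field, Heegner datum and `K`-rational point,
non-torsion by Gross–Zagier, Néron model of the twist with `twistTransportPackage_holds`, `htamK` by
`padicValNat_tamagawaProduct_baseChange_of_heegner_odd`, anticyclotomic `ℤ_p`-extension, generator,
degree-one prime).

* `bsdp_of_cellC_of_not_split_of_manin_of_intResiduals_of_partner` — pointwise, partner-supply form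
  (p409029's `…_of_manin_of_residuals_of_partner` without `hres`).
* `bsdp_of_cellC_of_not_split_of_manin_of_intResiduals` — pointwise with Mazur's MC on X2b ∩ {non-split}
  (p407684's `…_of_manin_of_residuals` without `hres`), derived from the partner-supply form.
* **`bsdp_of_cellC_of_not_split_of_intResiduals`** — CLASS LEVEL, the planner's `stub_nonsplit` of line
  b1 read ♭: `∀ W p, CellC W p → ¬ split → BSDp W p` ⇐ PUBLISHED facts + c2♭ + c3♭ (at every non-split
  CellC pair) + Mazur's MC on X2b ∩ {non-split}. NO c1.
* **`bsdp_of_cellCNonsplitNotGV_of_intResiduals`** — the ψ-even sub-cell `CellCNonsplitNotGV`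
  (2 552 @3, 93 @5, 17 @7 classes), class level, from c2♭ ∧ c3♭ + PUBLISHED facts, NO main-conjecture
  input and NO c1 (p409029's `bsdp_of_cellCNonsplitNotGV_of_residuals` without `hres`).

So the NON-SPLIT half of crux 4 `BSDpOnCellC` reads, with NO per-pair binder: PUBLISHED facts + c2♭ +
c3♭ + [Mazur's MC on X2b ∩ {non-split}] — the named residual c1 of skeleton b1 v1 is not among the
inputs. CONDITIONAL on every listed binder (c2♭/c3♭ are `@[conjecture]` predicates NOT in print at a
reducible `p ‖ N` for a general frame; Keller–Yin Thm. D is a PREPRINT with the L1754 gap; Hsieh 2014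
Thm. 1 is PUB). Nothing booked; no label change.

References: [CastellaEtAl2021] Thm. 5.3.1 and (5.6); [Hsieh2014] Thm. 1; [Castella2018] Thm. 2.3,
3.2, §5; [KellerYin2024] Thm. D (PRE); [Mazur1978] Cor. 4.1; [MilneADT2006] Thm. I.7.3 (Cassels);
[GrossZagier1986] I.(6.3), V.§2; [Gross1991] (1.1); [Darmon2004] Thm. 3.6; [SilvermanATAEC1994]
Thm. V.5.3, Cor. V.5.4; [GreenbergVatsal2000] Thm. (1.3); [Miller2011LMS] Def. 1.1.
-/

set_option autoImplicit false

noncomputable section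

open scoped Classical MatrixGroups ModularForm

open CongruenceSubgroup WeierstrassCurve NumberField IsDedekindDomain Field PowerSeries
  Literature.NumberTheory.EllipticCurves Literature.NumberTheory.EllipticCurves.GreenbergSelmer
  Literature.NumberTheory.EllipticCurves.ModularForms Literature.NumberTheory.QuadraticFields
  Literature.NumberTheory.EllipticCurves.Rank1Residual
  Literature.NumberTheory.EllipticCurves.Rank1Residual.Typed
  Literature.NumberTheory.EllipticCurves.KrizLi2019
  Literature.NumberTheory.EllipticCurves.GreenbergVatsal2000
  Literature.NumberTheory.EllipticCurves.Wuthrich2014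
  Literature.NumberTheory.EllipticCurves.SteinWuthrich2013
  Literature.NumberTheory.GaloisRepresentations Literature.NumberTheory.GaloisCohomology
  Literature.NumberTheory.Automorphic
  Summit.BirchSwinnertonDyer.Rank1Residual.X11b.AcSelmer
  Summit.BirchSwinnertonDyer.Rank1Residual.X11b.Halves
  Summit.BirchSwinnertonDyer.Rank1Residual.X11b

namespace Summit.BirchSwinnertonDyer.Rank1Residual.X2

/-! ### Pointwise: a non-split CellC pair carrying a Manin datum prime to `p` -/

section Pointwise

variable (W : WeierstrassCurve ℚ) [W.IsElliptic] [W.IsGloballyMinimal] (p : ℕ) [Fact p.Prime]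

/-- **Pointwise, partner-supply form, NO RESIDUAL c1.** p409029's
`bsdp_of_cellC_of_not_split_of_manin_of_residuals_of_partner` with the binder
`hres : HsiehFrameResidualAt W p` REMOVED and the halves read ♭: for a rank-one X2 pair `(E,p)` at a
NON-split `p` with `HasPrimeToManinDatum W p`, `BSD(E,p)` from the PUBLISHED named facts (incl. Hsieh
2014 Thm. 1 `hH` and the five cited cohomological facts of the control theorem), the two ♭ residuals
c2♭ `h2` / c3♭ `h3` AT THE PAIR, and the partner's rank-zero `p`-part as a SUPPLY over all admissible
`K` and all globally minimal models of the twist (`hpartner`). Every Heegner datum of the (b1) road is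
produced as in p407684 (Hoffstein–Luo field `exists_admissibleField_of_rootNumber_eq_neg_one`, Heegner
datum and `K`-rational point `hHP`, non-torsion by Gross–Zagier, Néron model of the twist with
`twistTransportPackage_holds`, `htamK` by `padicValNat_tamagawaProduct_baseChange_of_heegner_odd`,
anticyclotomic `ℤ_p`-extension `ZpExtension.exists_isAnticyclotomic_holds`, generator, degree-one prime
`X11b.exists_degreeOnePrime_of_splitsIn`), then `bsdp_of_cellC_of_not_split_of_hsieh2014_of_intHalvesOnTree_of_partner`.
CONDITIONAL on every listed binder; nothing booked. [cite: CastellaEtAl2021, Thm. 5.3.1 and (5.5)–(5.7)]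
[cite: Hsieh2014, Thm. 1 (arXiv:1112.1580 pp. 3–4)] [claim: KellerYin2024, status: under-review]
[cite: Gross1991, (1.1)] [cite: Darmon2004, Thm. 3.6–3.7] [cite: Miller2011LMS, Def. 1.1] -/
theorem bsdp_of_cellC_of_not_split_of_manin_of_intResiduals_of_partner
    (hnf : exists_isNewformOf)
    (hPT : ∀ (K : Type) [Field K] [NumberField K], poitouTate_selmerStructure_duality K)
    (hPT2 : ∀ (K : Type) [Field K] [NumberField K], poitouTate_sha_tateDual K)
    (hEP : ∀ (K : Type) [Field K] [NumberField K] (v : HeightOneSpectrum (𝓞 K)),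
      localEulerPoincareCharacteristic (v.adicCompletion K))
    (hcd : fieldCdLE_two_of_numberField)
    (hBr : ∀ (K : Type) [Field K] [NumberField K] (p : ℕ) [Fact p.Prime],
      ZpExtension.decomp_not_le_kerSubgroup_of_isAnticyclotomic K p)
    (hH : hsieh2014_exists_anticyclotomicPAdicLFunction)
    (hGZ : ∀ (N : ℕ) [NeZero N] (W : WeierstrassCurve ℚ) (K : Type) [Field K] [NumberField K],
      gross_zagier N W K)
    (hKo : ∀ (N : ℕ) [NeZero N] (W : WeierstrassCurve ℚ) (K : Type) [Field K] [NumberField K],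
      kolyvagin N W K)
    (hHP : ∀ (N : ℕ) [NeZero N] (W : WeierstrassCurve ℚ) (K : Type) [Field K] [NumberField K],
      heegnerPointComplex_mem_range_map N W K)
    (hGZK : rank_eq_analyticRank_of_analyticRank_le_one)
    (hHL : HoffsteinLuo1997_exists_twist_L_one_ne_zero)
    (hc : CellC W p) (hns : ¬ W.HasSplitMultiplicativeReductionAtPrime p)
    (hMan : HasPrimeToManinDatum W p)
    (h2 : NonsplitBDPValueOnTreeInt W p) (h3 : NonsplitIMCEqOnTreeInt W p)
    (hpartner : ∀ (K : Type) [Field K] [NumberField K], IsImaginaryQuadratic K →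
        Odd (NumberField.discr K) → NumberField.discr K < -4 →
        SatisfiesHeegnerHypothesis (W.conductorNorm ℤ) K → SatisfiesHeegnerHypothesis p K →
        (W.quadraticTwist (NumberField.discr K : ℚ)).entireLFunction 1 ≠ 0 →
      ∀ (Wd : WeierstrassCurve ℚ) [Wd.IsElliptic] [Wd.IsGloballyMinimal],
        (∃ C : VariableChange ℚ, C • Wd = W.quadraticTwist (NumberField.discr K : ℚ)) →
        Wd.analyticRank = 0 → PPartRankZero Wd p) :
    BSDp W p := by
  have hp : p.Prime := Fact.out
  have hmod : hasEntireLFunction_rat := WeierstrassCurve.hasEntireLFunction_rat_of_exists_isNewformOf hnf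
  obtain ⟨hr, hp2, hred, hmult⟩ := hc
  haveI : NeZero (W.conductorNorm ℤ) := ⟨(W.conductorNorm_pos_holds).ne'⟩
  -- `w(E) = -1`
  have hw : W.rootNumber = -1 := by
    rw [WeierstrassCurve.rootNumber_eq_neg_one_pow_analyticRank_of_exists_isNewformOf hnf W, hr]
    norm_num
  -- the admissible auxiliary field
  obtain ⟨K, _, _, hK, hodd, hlt, hHN, hHp, hLK⟩ :=
    exists_admissibleField_of_rootNumber_eq_neg_one hnf hHL W hw p
  -- the datum with `p ∤ c`, a Heegner datum and the `K`-rational Heegner point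
  obtain ⟨Dt, hcM⟩ := hMan
  obtain ⟨β, hβ⟩ := exists_dvd_sq_sub_discr_holds (W.conductorNorm ℤ) K hK hHN
  obtain ⟨H, -⟩ := nonempty_heegnerDatum_holds (W.conductorNorm ℤ) K hK hβ
  obtain ⟨ι⟩ : Nonempty (K →+* ℂ) := inferInstance
  obtain ⟨P, hP⟩ := hHP (W.conductorNorm ℤ) W K hK hHN Dt H ι
  -- the Heegner point has infinite order: `L'(E/K,1) = L'(E,1)·L(E^K,1) ≠ 0` (Gross–Zagier)
  have hL0 : W.entireLFunction 1 = 0 := entireLFunction_one_eq_zero_of_analyticRank_eq_one hr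
  obtain ⟨-, hderiv⟩ := leadingLCoeff_eq_deriv_of_analyticRank_eq_one hr
  have hLKd : LDerivEK W K ≠ 0 := by
    rw [lDerivEK_eq_deriv_mul W K hmod hL0]
    exact mul_ne_zero hderiv hLK
  have hPH : IsHeegnerPoint (W.conductorNorm ℤ) W K P := ⟨Dt, H, ι, hP⟩
  have hPinf : ¬ IsOfFinAddOrder P :=
    (lDerivEK_ne_zero_iff_not_isOfFinAddOrder W (W.conductorNorm ℤ) K (hGZ _ W K) hK hHN hPH).mp hLKd
  -- a globally minimal model of the twist (Néron) and its transport values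
  have hD0 : (NumberField.discr K : ℚ) ≠ 0 := by exact_mod_cast NumberField.discr_ne_zero K
  haveI hEt : (W.quadraticTwist (NumberField.discr K : ℚ)).IsElliptic :=
    W.isElliptic_quadraticTwist hD0
  obtain ⟨Cd, hCd⟩ := hasGlobalMinimalModel_rat_holds (W.quadraticTwist (NumberField.discr K : ℚ))
  set Wd : WeierstrassCurve ℚ := Cd • W.quadraticTwist (NumberField.discr K : ℚ) with hWd_def
  haveI : Wd.IsGloballyMinimal := hCd
  have hWd : Cd • W.quadraticTwist (NumberField.discr K : ℚ) = Wd := rfl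
  have hC : Cd⁻¹ • Wd = W.quadraticTwist (NumberField.discr K : ℚ) := by
    rw [← hWd, inv_smul_smul]
  obtain ⟨htam, hu⟩ := twistTransportPackage_holds W p K Wd Cd ⟨hr, hp2, hred, hmult⟩ hK hodd hHN hWd
  have htamK : padicValNat p (W.baseChange K).tamagawaProduct = 2 * padicValNat p W.tamagawaProduct :=
    padicValNat_tamagawaProduct_baseChange_of_heegner_odd W p hp2 K hK hodd hHN hHp
  -- the twist has analytic rank `0`; its rank-zero `p`-part from the supply
  have hLd : Wd.entireLFunction 1 ≠ 0 := by
    rw [← hWd, entireLFunction_smul]; exact hLK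
  have hrd : Wd.analyticRank = 0 := (Wd.analyticRank_eq_zero_iff_holds (hmod _)).2 hLd
  have htw : PPartRankZero Wd p := hpartner K hK hodd hlt hHN hHp hLK Wd ⟨Cd⁻¹, hC⟩ hrd
  -- the anticyclotomic `ℤ_p`-extension, a topological generator, a degree-one prime above `p`
  haveI : IsTotallyComplex K := hK.2
  obtain ⟨κ, hκ⟩ := ZpExtension.exists_isAnticyclotomic_holds (K := K) (p := p) hK.1
    (fun w ↦ IsTotallyComplex.isComplex w)
  obtain ⟨γ, hγ⟩ := κ.surjective (Multiplicative.ofAdd 1)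
  haveI : Fact (κ.IsTopGenerator γ) := ⟨hγ⟩
  obtain ⟨𝔭, h𝔭, he, hf⟩ := X11b.exists_degreeOnePrime_of_splitsIn K p hK.1 (hHp p hp dvd_rfl)
  -- conclude by the (b1) road over the wide receptacle
  exact bsdp_of_cellC_of_not_split_of_hsieh2014_of_intHalvesOnTree_of_partner W p hnf hPT hPT2 hEP hcd
    hBr hH (W.conductorNorm ℤ) K Dt H ι P (hGZ _ W K) (hKo _ W K) hGZK ⟨hr, hp2, hred, hmult⟩ hns rfl
    hK hlt hHN hHp hP hPinf hcM hLK Wd Cd hWd htw htam hu htamK κ hκ γ 𝔭 h𝔭 he hf h2 h3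

/-- **X2c ∩ {non-split} ⇒ `BSD(E,p)` at a pair carrying a Manin datum prime to `p`, from the two ♭
residuals at the pair, Mazur's MC on X2b ∩ {non-split}, and PUBLISHED facts — NO RESIDUAL c1.**
p407684's `bsdp_of_cellC_of_not_split_of_manin_of_residuals` with `hres` REMOVED and the halves read
♭; the partner's rank-zero `p`-part is supplied by cases on its Greenberg–Vatsal parity — X2a is CLOSED
(`targetA_of_published`), X2b ∩ {non-split} is the input `hMCB` (the twist is X2 and stays non-split at
`p`: `classX2_twist`, `not_hasSplitMultiplicativeReductionAtPrime_of_smul_eq_quadraticTwist`) through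
`bsdp_of_mazurMainConjectureAt_of_analyticRank_eq_zero`. CONDITIONAL on every listed binder; nothing
booked; no label change. [cite: CastellaEtAl2021, Thm. 5.3.1 and (5.5)–(5.7)]
[cite: Hsieh2014, Thm. 1 (arXiv:1112.1580 pp. 3–4)] [claim: KellerYin2024, status: under-review]
[cite: GreenbergLNM1716, §1] [cite: Gross1991, (1.1)] [cite: Miller2011LMS, Def. 1.1] -/
theorem bsdp_of_cellC_of_not_split_of_manin_of_intResiduals
    (hGV : lambdaMu_multiplicative_of_gvPar) (hWu : thm16_charIdeal_dvd_multiplicative_of_reducible)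
    (hJs : thm61_splitMultiplicative) (hJn : thm61_nonsplitMultiplicative)
    (hHs : exists_isSplitMultCanonical) (hHn : exists_isMultCanonical)
    (hpar : nonempty_modularParametrizationData)
    (hGS : ∀ (W : WeierstrassCurve ℚ) [W.IsElliptic] [W.IsGloballyMinimal] (p : ℕ) [Fact p.Prime],
      greenberg_stevens (W := W) (p := p))
    (hnf : exists_isNewformOf)
    (hPT : ∀ (K : Type) [Field K] [NumberField K], poitouTate_selmerStructure_duality K)
    (hPT2 : ∀ (K : Type) [Field K] [NumberField K], poitouTate_sha_tateDual K)
    (hEP : ∀ (K : Type) [Field K] [NumberField K] (v : HeightOneSpectrum (𝓞 K)),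
      localEulerPoincareCharacteristic (v.adicCompletion K))
    (hcd : fieldCdLE_two_of_numberField)
    (hBr : ∀ (K : Type) [Field K] [NumberField K] (p : ℕ) [Fact p.Prime],
      ZpExtension.decomp_not_le_kerSubgroup_of_isAnticyclotomic K p)
    (hH : hsieh2014_exists_anticyclotomicPAdicLFunction)
    (hGZ : ∀ (N : ℕ) [NeZero N] (W : WeierstrassCurve ℚ) (K : Type) [Field K] [NumberField K],
      gross_zagier N W K)
    (hKo : ∀ (N : ℕ) [NeZero N] (W : WeierstrassCurve ℚ) (K : Type) [Field K] [NumberField K],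
      kolyvagin N W K)
    (hHP : ∀ (N : ℕ) [NeZero N] (W : WeierstrassCurve ℚ) (K : Type) [Field K] [NumberField K],
      heegnerPointComplex_mem_range_map N W K)
    (hGZK : rank_eq_analyticRank_of_analyticRank_le_one)
    (hHL : HoffsteinLuo1997_exists_twist_L_one_ne_zero)
    (hc : CellC W p) (hns : ¬ W.HasSplitMultiplicativeReductionAtPrime p)
    (hMan : HasPrimeToManinDatum W p)
    (h2 : NonsplitBDPValueOnTreeInt W p) (h3 : NonsplitIMCEqOnTreeInt W p)
    (hMCB : ∀ (W' : WeierstrassCurve ℚ) [W'.IsElliptic] [W'.IsGloballyMinimal],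
      CellB W' p → ¬ W'.HasSplitMultiplicativeReductionAtPrime p → MazurMainConjectureAt W' p) :
    BSDp W p := by
  have hmod : hasEntireLFunction_rat := WeierstrassCurve.hasEntireLFunction_rat_of_exists_isNewformOf hnf
  refine bsdp_of_cellC_of_not_split_of_manin_of_intResiduals_of_partner W p hnf hPT hPT2 hEP hcd hBr
    hH hGZ hKo hHP hGZK hHL hc hns hMan h2 h3 ?_
  intro K _ _ hK _ _ _ hHp _ Wd _ _ hWd hrd
  obtain ⟨C, hC⟩ := hWd
  -- the twist is X2 and NON-split at `p`; its rank-zero `p`-part by parity cases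
  have hXd : ClassX2 Wd p := classX2_twist W p hc.2 K hK hHp Wd ⟨C, hC⟩
  have hnsd : ¬ Wd.HasSplitMultiplicativeReductionAtPrime p :=
    not_hasSplitMultiplicativeReductionAtPrime_of_smul_eq_quadraticTwist W Wd hK p hc.2.1 hc.2.2.2
      hns hHp hC
  have hbsdd : BSDp Wd p := by
    by_cases hgv : GVPar Wd p
    · exact targetA_of_published hGV hWu hJs hJn hHs hHn hGZK hmod hpar hGS Wd p ⟨hrd, hXd, hgv⟩
    · exact bsdp_of_mazurMainConjectureAt_of_analyticRank_eq_zero hJs hJn hHs hHn hGZK hmod hpar Wd p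
        (hGS Wd p) hXd.1 hXd.2.2 hrd (hMCB Wd ⟨hrd, hXd, hgv⟩ hnsd)
  exact pPartRankZero_of_pPart hGZK Wd p hrd (pPart_of_bsdp hmod hGZK Wd p (by omega) hbsdd)

end Pointwise

/-! ### Class level: the Manin condition moved to the optimal curve -/

section ClassLevel

/-- **X2c ∩ {non-split} ⇒ `BSD(E,p)`, CLASS LEVEL, over the wide receptacle — the planner's
`stub_nonsplit` of line b1 from c2♭ ∧ c3♭ + Mazur's MC on X2b ∩ {non-split} + PUBLISHED facts, NO
residual c1 and NO per-pair binder.** p407684's `bsdp_of_cellC_of_not_split_of_residuals` with the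
binder `hres` REMOVED and the halves read ♭ (`NonsplitBDPValueOnTreeInt`, `NonsplitIMCEqOnTreeInt` at
every non-split CellC pair). Proof: the `X₀(N)`-optimal curve `W₀ ∼ W` carries a Manin datum prime to
`p` (`bsdp_of_cellC_of_forall_isIsogenous`: Edixhoven, Mazur 1978 Cor. 4.1, modularity, Cassels); CellC
and non-splitness pass to `W₀`; the pointwise theorem at `W₀`. CONDITIONAL on every listed binder;
nothing booked; X2 CONSTRUCTION-SHAPED; no label change.
[cite: CastellaEtAl2021, Thm. 5.3.1] [cite: Mazur1978, Cor. 4.1] [cite: MilneADT2006, Thm. I.7.3]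
[cite: Hsieh2014, Thm. 1 (arXiv:1112.1580 pp. 3–4)] [claim: KellerYin2024, status: under-review]
[cite: Miller2011LMS, Def. 1.1] -/
theorem bsdp_of_cellC_of_not_split_of_intResiduals
    (hGV : lambdaMu_multiplicative_of_gvPar) (hWu : thm16_charIdeal_dvd_multiplicative_of_reducible)
    (hJs : thm61_splitMultiplicative) (hJn : thm61_nonsplitMultiplicative)
    (hHs : exists_isSplitMultCanonical) (hHn : exists_isMultCanonical)
    (hpar : nonempty_modularParametrizationData)
    (hGS : ∀ (W : WeierstrassCurve ℚ) [W.IsElliptic] [W.IsGloballyMinimal] (p : ℕ) [Fact p.Prime],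
      greenberg_stevens (W := W) (p := p))
    (hnf : exists_isNewformOf)
    (hPT : ∀ (K : Type) [Field K] [NumberField K], poitouTate_selmerStructure_duality K)
    (hPT2 : ∀ (K : Type) [Field K] [NumberField K], poitouTate_sha_tateDual K)
    (hEP : ∀ (K : Type) [Field K] [NumberField K] (v : HeightOneSpectrum (𝓞 K)),
      localEulerPoincareCharacteristic (v.adicCompletion K))
    (hcd : fieldCdLE_two_of_numberField)
    (hBr : ∀ (K : Type) [Field K] [NumberField K] (p : ℕ) [Fact p.Prime],
      ZpExtension.decomp_not_le_kerSubgroup_of_isAnticyclotomic K p)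
    (hH : hsieh2014_exists_anticyclotomicPAdicLFunction)
    (hGZ : ∀ (N : ℕ) [NeZero N] (W : WeierstrassCurve ℚ) (K : Type) [Field K] [NumberField K],
      gross_zagier N W K)
    (hKo : ∀ (N : ℕ) [NeZero N] (W : WeierstrassCurve ℚ) (K : Type) [Field K] [NumberField K],
      kolyvagin N W K)
    (hHP : ∀ (N : ℕ) [NeZero N] (W : WeierstrassCurve ℚ) (K : Type) [Field K] [NumberField K],
      heegnerPointComplex_mem_range_map N W K)
    (hGZK : rank_eq_analyticRank_of_analyticRank_le_one)
    (hHL : HoffsteinLuo1997_exists_twist_L_one_ne_zero)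
    (hEd : edixhoven_optimalManinConstant_integral) (hMaz : mazur_not_dvd_maninConstant_of_odd)
    (hCassels : bsdRHS_eq_of_isIsogenous)
    (h2 : ∀ (W : WeierstrassCurve ℚ) [W.IsElliptic] [W.IsGloballyMinimal] (p : ℕ) [Fact p.Prime],
      CellC W p → ¬ W.HasSplitMultiplicativeReductionAtPrime p → NonsplitBDPValueOnTreeInt W p)
    (h3 : ∀ (W : WeierstrassCurve ℚ) [W.IsElliptic] [W.IsGloballyMinimal] (p : ℕ) [Fact p.Prime],
      CellC W p → ¬ W.HasSplitMultiplicativeReductionAtPrime p → NonsplitIMCEqOnTreeInt W p)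
    (hMCB : ∀ (W : WeierstrassCurve ℚ) [W.IsElliptic] [W.IsGloballyMinimal] (p : ℕ) [Fact p.Prime],
      CellB W p → ¬ W.HasSplitMultiplicativeReductionAtPrime p → MazurMainConjectureAt W p)
    (W : WeierstrassCurve ℚ) [W.IsElliptic] [W.IsGloballyMinimal] (p : ℕ) [Fact p.Prime]
    (hc : CellC W p) (hns : ¬ W.HasSplitMultiplicativeReductionAtPrime p) : BSDp W p := by
  refine bsdp_of_cellC_of_forall_isIsogenous hEd hMaz hCassels hpar hnf hGZK W p hc ?_
  intro W₀ _ _ hiso hc₀ hMan₀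
  have hns₀ : ¬ W₀.HasSplitMultiplicativeReductionAtPrime p := fun h ↦
    hns (IsogenyQuotientLine.hasSplitMultiplicativeReductionAtPrime_of_isIsogenous
      hiso.symm_of_charZero h)
  exact bsdp_of_cellC_of_not_split_of_manin_of_intResiduals W₀ p hGV hWu hJs hJn hHs hHn hpar hGS hnf
    hPT hPT2 hEP hcd hBr hH hGZ hKo hHP hGZK hHL hc₀ hns₀ hMan₀ (h2 W₀ p hc₀ hns₀) (h3 W₀ p hc₀ hns₀)
    (fun W' _ _ hB hns' ↦ hMCB W' p hB hns')

/-- **The ψ-even non-split sub-cell `CellCNonsplitNotGV` (2 552 @3, 93 @5, 17 @7 classes) at the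
CLASS LEVEL over the wide receptacle, from c2♭ ∧ c3♭ + PUBLISHED facts — NO main-conjecture input, NO
residual c1.** p409029's `bsdp_of_cellCNonsplitNotGV_of_residuals` with `hres` REMOVED and the halves
read ♭: the CGLS partner `E^{d_K}` of a ψ-even pair has the Greenberg–Vatsal parity (an isogeny
invariant at a multiplicative prime by the two Tate-uniformisation facts `hT`, `hT'`,
`gvPar_iff_of_isIsogenous_of_mult`) and lies in the CLOSED sub-cell X2a (`pPartRankZero_twist_of_not_gvPar`),
so crux 3 of route `EisensteinPrimes` is not touched; the Manin condition is moved to the optimal curve.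
CONDITIONAL on every listed binder; nothing booked; X2 CONSTRUCTION-SHAPED; no label change.
[cite: CastellaEtAl2021, Thm. 5.3.1] [cite: GreenbergVatsal2000, Thm. (1.3) and §2 p. 28]
[cite: SilvermanATAEC1994, Thm. V.5.3 and Cor. V.5.4] [cite: Mazur1978, Cor. 4.1]
[cite: Hsieh2014, Thm. 1 (arXiv:1112.1580 pp. 3–4)] [claim: KellerYin2024, status: under-review]
[cite: Miller2011LMS, Def. 1.1] -/
theorem bsdp_of_cellCNonsplitNotGV_of_intResiduals
    (hGV : lambdaMu_multiplicative_of_gvPar) (hWu : thm16_charIdeal_dvd_multiplicative_of_reducible)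
    (hJs : thm61_splitMultiplicative) (hJn : thm61_nonsplitMultiplicative)
    (hHs : exists_isSplitMultCanonical) (hHn : exists_isMultCanonical)
    (hpar : nonempty_modularParametrizationData)
    (hGS : ∀ (W : WeierstrassCurve ℚ) [W.IsElliptic] [W.IsGloballyMinimal] (p : ℕ) [Fact p.Prime],
      greenberg_stevens (W := W) (p := p))
    (hnf : exists_isNewformOf)
    (hPT : ∀ (K : Type) [Field K] [NumberField K], poitouTate_selmerStructure_duality K)
    (hPT2 : ∀ (K : Type) [Field K] [NumberField K], poitouTate_sha_tateDual K)
    (hEP : ∀ (K : Type) [Field K] [NumberField K] (v : HeightOneSpectrum (𝓞 K)),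
      localEulerPoincareCharacteristic (v.adicCompletion K))
    (hcd : fieldCdLE_two_of_numberField)
    (hBr : ∀ (K : Type) [Field K] [NumberField K] (p : ℕ) [Fact p.Prime],
      ZpExtension.decomp_not_le_kerSubgroup_of_isAnticyclotomic K p)
    (hH : hsieh2014_exists_anticyclotomicPAdicLFunction)
    (hGZ : ∀ (N : ℕ) [NeZero N] (W : WeierstrassCurve ℚ) (K : Type) [Field K] [NumberField K],
      gross_zagier N W K)
    (hKo : ∀ (N : ℕ) [NeZero N] (W : WeierstrassCurve ℚ) (K : Type) [Field K] [NumberField K],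
      kolyvagin N W K)
    (hHP : ∀ (N : ℕ) [NeZero N] (W : WeierstrassCurve ℚ) (K : Type) [Field K] [NumberField K],
      heegnerPointComplex_mem_range_map N W K)
    (hGZK : rank_eq_analyticRank_of_analyticRank_le_one)
    (hHL : HoffsteinLuo1997_exists_twist_L_one_ne_zero)
    (hEd : edixhoven_optimalManinConstant_integral) (hMaz : mazur_not_dvd_maninConstant_of_odd)
    (hCassels : bsdRHS_eq_of_isIsogenous)
    (hT : Silverman1994_thmV53_tateUniformisation.{0})
    (hT' : Silverman1994_thmV53_corV54_tateUniformisation.{0})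
    (h2 : ∀ (W : WeierstrassCurve ℚ) [W.IsElliptic] [W.IsGloballyMinimal] (p : ℕ) [Fact p.Prime],
      CellC W p → ¬ W.HasSplitMultiplicativeReductionAtPrime p → NonsplitBDPValueOnTreeInt W p)
    (h3 : ∀ (W : WeierstrassCurve ℚ) [W.IsElliptic] [W.IsGloballyMinimal] (p : ℕ) [Fact p.Prime],
      CellC W p → ¬ W.HasSplitMultiplicativeReductionAtPrime p → NonsplitIMCEqOnTreeInt W p)
    (W : WeierstrassCurve ℚ) [W.IsElliptic] [W.IsGloballyMinimal] (p : ℕ) [Fact p.Prime]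
    (hc : CellCNonsplitNotGV W p) : BSDp W p := by
  obtain ⟨hcC, hns, hnot⟩ := hc
  have hmod : hasEntireLFunction_rat := WeierstrassCurve.hasEntireLFunction_rat_of_exists_isNewformOf hnf
  refine bsdp_of_cellC_of_forall_isIsogenous hEd hMaz hCassels hpar hnf hGZK W p hcC ?_
  intro W₀ _ _ hiso hc₀ hMan₀
  have hns₀ : ¬ W₀.HasSplitMultiplicativeReductionAtPrime p := fun h ↦
    hns (IsogenyQuotientLine.hasSplitMultiplicativeReductionAtPrime_of_isIsogenous
      hiso.symm_of_charZero h)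
  have hnot₀ : ¬ GVPar W₀ p := fun h ↦
    hnot ((gvPar_iff_of_isIsogenous_of_mult hT hT' hcC.2.1 hcC.2.2.2 hiso).mpr h)
  exact bsdp_of_cellC_of_not_split_of_manin_of_intResiduals_of_partner W₀ p hnf hPT hPT2 hEP hcd hBr
    hH hGZ hKo hHP hGZK hHL hc₀ hns₀ hMan₀ (h2 W₀ p hc₀ hns₀) (h3 W₀ p hc₀ hns₀)
    (fun K _ _ hK _ _ _ hHp _ Wd _ _ hWd hrd ↦
      pPartRankZero_twist_of_not_gvPar hGV hWu hJs hJn hHs hHn hGZK hmod hpar hGS W₀ p hc₀.2 hnot₀ K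
        hK hHp Wd hWd hrd)

end ClassLevel

end Summit.BirchSwinnertonDyer.Rank1Residual.X2

end
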